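import Mathlib
import HarnessLib

/-!
# Finite-range decomposition of gradient Gaussian fields on the torus, with regularity in the
# coefficients (Buchholz; Adams–Buchholz–Kotecký–Müller Thm 6.1) — STATEMENT (named fact)

On the discrete torus `T_N = (ℤ/L^N ℤ)^d` (`L > 3` odd, `N ≥ 1`, `d ≥ 3`), scalar fields (`m = 1`) with
zero average, and a constant-coefficient elliptic difference operator `𝒜_A = ∇* A ∇ = Σ_{i,j} A_{ij} ∇_i^* ∇_j`
(`A` a real symmetric `d × d` matrix with `ω₀|z|² ≤ z·Az ≤ Ω₀|z|²`, i.e. the class `𝓛(𝒢, ω₀, Ω₀)` of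
the source for the index set of first-order gradients), the Green's function `𝒞_A = 𝒜_A⁻¹` admits,
for every pair of integers `ñ > n`, a FINITE-RANGE DECOMPOSITION `𝒞_A = Σ_{k=1}^{N+1} 𝒞_{A,k}` into
translation-invariant positive kernels with `𝒞_{A,k}(x) = M_k` (a constant `≤ 0` independent of `A`)
for `|x|_∞ ≥ L^k/2`, `k ≤ N`, obeying
* the real-space bounds `|∇^α D_A^ℓ 𝒞_{A,k}(x)(Ȧ,…,Ȧ)| ≤ C(α,ℓ) L^{−(k−1)(d−2+|α|)}` for
  `|α|₁ ≤ n`, `‖Ȧ‖ ≤ 1`, with `C(α,ℓ)` independent of `L`, `N`, `k` (here `d ≥ 3`, so `d + |α| > 2`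
  always and no `log L` appears);
* lower and upper bounds for the Fourier coefficients `𝒞̂_{A,k}(p)` on the dyadic shells
  `𝔸_j = {L^{−j−1} < |p| ≤ L^{−j}}` (`𝔸_0 = {|p| > L^{−1}}`):
  `c L^{−2(d+ñ)−1} L^{2j} L^{−(k−j)(d−1+n)} ≤ 𝒞̂_{A,k}(p) ≤ C L^{2(d+ñ)+1} L^{2j} L^{−(k−j)(d−1+n)}`
  for `j < k` and `c L^{−2(d+ñ)−1} L^{2k} ≤ 𝒞̂_{A,k}(p) ≤ C L^{2k}` for `j ≥ k`;
* the stronger bound `|d^ℓ/ds^ℓ 𝒞̂_{A+sȦ,k}(p)| ≤ C_ℓ L^{2(d+ñ)+1} L^{2j} L^{−(k−j)(d−1+ñ)}` (`j < k`),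
  `≤ C_ℓ L^{2k}` (`j ≥ k`), for `ℓ ≥ 1`.
This is Theorem 2.4 of Buchholz (J. Funct. Anal. 275 (2018); arXiv:1603.06685), restated as
Theorem 6.1 of Adams–Buchholz–Kotecký–Müller (arXiv:1910.13564), SPECIALISED to one component and
first-order gradients and to `d ≥ 3`.  It is the Gaussian input of the renormalisation-group analysis
of gradient models with non-convex / complex perturbations (the `q`-family `μ^{(q)}` of ABKM19 is
`A = 𝟙 − q`); the regularity in `A` (directional derivatives `D_A^ℓ`) and the Fourier lower bounds
are what make the integration maps differentiable in `A` uniformly in `N` (source, Thm 4.5).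

## Contents
* lattice calculus on `(ℤ/M)^d`: `supNorm`, `fwdDiff`, `bwdDiff`, `iterDiff`, `conv`, `ellOp`,
  `dualMomentum`, `momNorm`, `fourierCoeff`, `InShell`;
* the coefficient classes `IsElliptic ω₀ Ω₀ A`, `IsUnitSymm Ȧ`;
* the named fact `TorusFRD d` (a `Prop`; NOT proved here).
Proof status: NOT formalised.  The tree holds an exact algebraic (Fejér–Chebyshev) finite-range
decomposition for every symmetric `0 ≤ A ≤ 4` (`Literature/Analysis/Matrix/FiniteRangeDecomposition.lean`,
proved): positivity, finite range and symmetry come for free there; the kernel decay and Fourier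
shell bounds of the present statement are the analytic half still to be supplied.

-- TODO(general form): `m ≥ 1` components, index sets `𝓜` with higher derivatives (range `R`),
-- and `d = 2` (where `C(0,ℓ)` acquires a factor `log L`), as in the source.

## References
* S. Buchholz, *Finite range decomposition for Gaussian measures with improved regularity*,
  J. Funct. Anal. 275 (2018) 1674–1711, arXiv:1603.06685 — Sec. 2 (setting), Theorem 2.4
  [Buchholz2016].
* S. Adams, S. Buchholz, R. Kotecký, S. Müller, *Cauchy–Born rule from microscopic models with
  non-convex potentials*, arXiv:1910.13564 — Ch. 6, Theorem 6.1 (the same statement as used by the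
  renormalisation group) [AdamsBuchholzKoteckyMuller2019].
* S. Adams, R. Kotecký, S. Müller, *Finite range decomposition for families of gradient Gaussian
  measures*, J. Funct. Anal. 264 (2013) 169–206 — Thm 2.1 (the version without Fourier lower bounds).
-/

noncomputable section

namespace Literature.MathematicalPhysics.StatisticalMechanics.GradientFRD

open scoped BigOperators

variable {d M : ℕ}

/-! ## Lattice calculus on the discrete torus `(ℤ/M)^d` -/

/-- The sup-distance from the origin on the torus `(ℤ/M)^d`: `|x|_∞ = max_i |x_i|`, with `|x_i|`
the absolute value of the symmetric representative of `x_i ∈ ℤ/M` in `(−M/2, M/2]`. [folklore] -/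
def supNorm (x : Fin d → ZMod M) : ℕ :=
  Finset.univ.sup fun i => ((x i).valMinAbs).natAbs

/-- Forward lattice derivative `(∇_i f)(x) = f(x + e_i) − f(x)`. [folklore] -/
def fwdDiff (i : Fin d) (f : (Fin d → ZMod M) → ℝ) : (Fin d → ZMod M) → ℝ :=
  fun x => f (x + Pi.single i 1) - f x

/-- Backward lattice derivative `(∇_i^* f)(x) = f(x − e_i) − f(x)` (the `ℓ²`-adjoint of `∇_i`).
[folklore] -/
def bwdDiff (i : Fin d) (f : (Fin d → ZMod M) → ℝ) : (Fin d → ZMod M) → ℝ :=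
  fun x => f (x - Pi.single i 1) - f x

/-- Iterated forward derivative `∇^α = Π_i ∇_i^{α_i}` (the `∇_i` commute, so the order of
composition is immaterial). [folklore] -/
def iterDiff (α : Fin d → ℕ) (f : (Fin d → ZMod M) → ℝ) : (Fin d → ZMod M) → ℝ :=
  (List.finRange d).foldr (fun i g => (fwdDiff i)^[α i] g) f

/-- Convolution of a translation-invariant kernel with a field: `(𝒞 ⋆ φ)(x) = Σ_y 𝒞(x − y) φ(y)` —
the operator with kernel `𝒞`. [folklore] -/
def conv [NeZero M] (𝒞 φ : (Fin d → ZMod M) → ℝ) : (Fin d → ZMod M) → ℝ :=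
  fun x => ∑ y : Fin d → ZMod M, 𝒞 (x - y) * φ y

/-- The constant-coefficient elliptic difference operator `𝒜_A = ∇* A ∇ = Σ_{i,j} A_{ij} ∇_i^* ∇_j`
(one component, first-order gradients). [cite: Buchholz2016, Sec. 2] -/
def ellOp (A : Matrix (Fin d) (Fin d) ℝ) (φ : (Fin d → ZMod M) → ℝ) : (Fin d → ZMod M) → ℝ :=
  fun x => ∑ i : Fin d, ∑ j : Fin d, A i j * bwdDiff i (fwdDiff j φ) x

/-- The ellipticity class `𝓛(ω₀, Ω₀)` for one component and first-order gradients: `A` real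
symmetric with `ω₀ |z|² ≤ z·Az ≤ Ω₀ |z|²` (the lower bound is the source's `Q(z) ≥ ω₀|z^∇|²`, the
upper bound its `‖A‖ ≤ Ω₀` for symmetric non-negative `A`). [cite: Buchholz2016, Sec. 2] -/
def IsElliptic (ω₀ Ω₀ : ℝ) (A : Matrix (Fin d) (Fin d) ℝ) : Prop :=
  A.IsSymm ∧ ∀ z : Fin d → ℝ,
    ω₀ * ∑ i, (z i) ^ 2 ≤ ∑ i, ∑ j, z i * A i j * z j ∧
      ∑ i, ∑ j, z i * A i j * z j ≤ Ω₀ * ∑ i, (z i) ^ 2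

/-- Directions `Ȧ` of operator norm at most one (`sup_{‖Ȧ‖ ≤ 1}` in the source's bounds): real
symmetric with `|z·Ȧz| ≤ |z|²`. [cite: Buchholz2016, Thm 2.4] -/
def IsUnitSymm (B : Matrix (Fin d) (Fin d) ℝ) : Prop :=
  B.IsSymm ∧ ∀ z : Fin d → ℝ, abs (∑ i, ∑ j, z i * B i j * z j) ≤ ∑ i, (z i) ^ 2

/-- The dual momentum of `κ ∈ (ℤ/M)^d`: `p_i = 2π κ_i / M ∈ (−π, π]` (symmetric representative),
i.e. the point of the dual torus `T̂ = (2π/M)·{−(M−1)/2, …, (M−1)/2}^d` for odd `M`.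
[cite: Buchholz2016, Sec. 2] -/
def dualMomentum (κ : Fin d → ZMod M) : Fin d → ℝ :=
  fun i => 2 * Real.pi * ((κ i).valMinAbs : ℝ) / (M : ℝ)

/-- Euclidean length `|p|` of the dual momentum. [cite: Buchholz2016, Sec. 2] -/
def momNorm (κ : Fin d → ZMod M) : ℝ :=
  Real.sqrt (∑ i, (dualMomentum κ i) ^ 2)

/-- The Fourier coefficient `𝒞̂(p) = Σ_x e^{−i p·x} 𝒞(x)` of a kernel on the torus at the dual momentum
`p = p(κ)` (well defined: `x ↦ e^{ip·x}` is `M`-periodic). [cite: Buchholz2016, Sec. 2] -/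
def fourierCoeff [NeZero M] (𝒞 : (Fin d → ZMod M) → ℝ) (κ : Fin d → ZMod M) : ℂ :=
  ∑ x : Fin d → ZMod M, (𝒞 x : ℂ) *
    Complex.exp (-(Complex.I * ((∑ i, dualMomentum κ i * ((x i).valMinAbs : ℝ) : ℝ) : ℂ)))

/-- Membership of the dual momentum `p(κ)` in the dyadic shell `𝔸_j`:
`𝔸_0 = {|p| > L⁻¹}`, `𝔸_j = {L^{−j−1} < |p| ≤ L^{−j}}` for `j ≥ 1`. [cite: Buchholz2016, Sec. 2] -/
def InShell (L : ℕ) (j : ℕ) (κ : Fin d → ZMod M) : Prop :=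
  (j = 0 ∧ ((L : ℝ) ^ 1)⁻¹ < momNorm κ) ∨
    (1 ≤ j ∧ ((L : ℝ) ^ (j + 1))⁻¹ < momNorm κ ∧ momNorm κ ≤ ((L : ℝ) ^ j)⁻¹)

/-! ## The named fact -/

/-- **Finite-range decomposition with improved regularity on the torus** (Buchholz 2018, Thm 2.4 =
ABKM19 Thm 6.1; special case `m = 1`, first-order gradients, `d ≥ 3`).  For `0 < ω₀ < Ω₀` and
integers `n < ñ` there are kernels `𝒞_{A,k} : (ℤ/L^N)^d → ℝ` (`k = 1,…,N+1`, for every odd `L > 3`,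
`N ≥ 1`, `A ∈ 𝓛(ω₀,Ω₀)`), constants `M_k = M_k(L,N) ≤ 0` independent of `A`, and constants
`C(α,ℓ)`, `c > 0`, `C`, `C_ℓ` independent of `L`, `N`, `k`, `A`, such that:
(o) each `𝒞_{A,k}` has zero average and is even (`𝒞(−x) = 𝒞(x)`: a symmetric operator);
(i) positivity: `Σ_{x,y} φ(x) 𝒞_{A,k}(x−y) φ(y) ≥ 0` for every zero-average `φ`;
(ii) decomposition of the Green's function: `𝒜_A ((Σ_{k=1}^{N+1} 𝒞_{A,k}) ⋆ φ) = φ` for every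
zero-average `φ`;
(iii) finite range: `𝒞_{A,k}(x) = M_k` whenever `|x|_∞ ≥ L^k/2`, `1 ≤ k ≤ N`;
(iv) regularity and real-space bounds: for `|α|₁ ≤ n`, `ℓ ≥ 0`, `Ȧ` symmetric of norm `≤ 1`, the
map `s ↦ 𝒞_{A+sȦ,k}(x)` is smooth near `s = 0` and
`|∇^α (d/ds)^ℓ 𝒞_{A+sȦ,k}(x)|_{s=0}| ≤ C(α,ℓ) · L^{−(k−1)(d−2+|α|₁)}`;
(v) Fourier shell bounds: for `p = p(κ) ∈ 𝔸_j`, `κ ≠ 0`: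
`c L^{−(2(d+ñ)+1)} L^{2j} L^{−(k−j)(d−1+n)} ≤ Re 𝒞̂_{A,k}(p)` and
`|𝒞̂_{A,k}(p)| ≤ C L^{2(d+ñ)+1} L^{2j} L^{−(k−j)(d−1+n)}` if `j < k`;
`c L^{−(2(d+ñ)+1)} L^{2k} ≤ Re 𝒞̂_{A,k}(p)` and `|𝒞̂_{A,k}(p)| ≤ C L^{2k}` if `k ≤ j`;
and for `ℓ ≥ 1`: `|(d/ds)^ℓ 𝒞̂_{A+sȦ,k}(p)|_{s=0}| ≤ C_ℓ L^{2(d+ñ)+1} L^{2j} L^{−(k−j)(d−1+ñ)}`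
if `j < k`, `≤ C_ℓ L^{2k}` if `k ≤ j`.
Negative powers of `L` are written as quotients.  [cite: Buchholz2016, Thm 2.4] -/
def TorusFRD (d : ℕ) : Prop :=
  3 ≤ d → ∀ ω₀ Ω₀ : ℝ, 0 < ω₀ → ω₀ < Ω₀ → ∀ n ñ : ℕ, n < ñ →
    ∃ (𝒞 : (L N M : ℕ) → Matrix (Fin d) (Fin d) ℝ → ℕ → (Fin d → ZMod M) → ℝ)
      (Mc : ℕ → ℕ → ℕ → ℝ) (Cα : (Fin d → ℕ) → ℕ → ℝ) (c C : ℝ) (Cℓ : ℕ → ℝ),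
      0 < c ∧
      ∀ L : ℕ, Odd L → 3 < L → ∀ N : ℕ, 1 ≤ N → ∀ (M : ℕ) [NeZero M], M = L ^ N →
        ∀ A : Matrix (Fin d) (Fin d) ℝ, IsElliptic ω₀ Ω₀ A →
          (∀ k, 1 ≤ k → k ≤ N + 1 →
            ∑ x : Fin d → ZMod M, 𝒞 L N M A k x = 0 ∧ ∀ x, 𝒞 L N M A k (-x) = 𝒞 L N M A k x) ∧
          (∀ k, 1 ≤ k → k ≤ N + 1 → ∀ φ : (Fin d → ZMod M) → ℝ, ∑ x, φ x = 0 →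
            0 ≤ ∑ x, ∑ y, φ x * 𝒞 L N M A k (x - y) * φ y) ∧
          (∀ φ : (Fin d → ZMod M) → ℝ, ∑ x, φ x = 0 →
            ellOp A (conv (fun x => ∑ k ∈ Finset.Icc 1 (N + 1), 𝒞 L N M A k x) φ) = φ) ∧
          (∀ k, 1 ≤ k → k ≤ N → Mc L N k ≤ 0 ∧
            ∀ x : Fin d → ZMod M, ((L : ℝ) ^ k) / 2 ≤ (supNorm x : ℝ) →
              𝒞 L N M A k x = Mc L N k) ∧
          (∀ k, 1 ≤ k → k ≤ N + 1 → ∀ B : Matrix (Fin d) (Fin d) ℝ, IsUnitSymm B →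
            (∃ ε : ℝ, 0 < ε ∧ ∀ x : Fin d → ZMod M,
              ContDiffOn ℝ ⊤ (fun s : ℝ => 𝒞 L N M (A + s • B) k x) (Set.Ioo (-ε) ε)) ∧
            ∀ α : Fin d → ℕ, ∑ i, α i ≤ n → ∀ ℓ : ℕ, ∀ x : Fin d → ZMod M,
              abs (iteratedDeriv ℓ (fun s : ℝ => iterDiff α (𝒞 L N M (A + s • B) k) x) 0)
                ≤ Cα α ℓ / (L : ℝ) ^ ((k - 1) * (d - 2 + ∑ i, α i))) ∧
          (∀ k, 1 ≤ k → k ≤ N + 1 → ∀ j : ℕ, ∀ κ : Fin d → ZMod M, κ ≠ 0 → InShell L j κ →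
            (j < k →
              c / (L : ℝ) ^ (2 * (d + ñ) + 1) * (L : ℝ) ^ (2 * j)
                  / (L : ℝ) ^ ((k - j) * (d - 1 + n)) ≤ (fourierCoeff (𝒞 L N M A k) κ).re ∧
              ‖fourierCoeff (𝒞 L N M A k) κ‖
                ≤ C * (L : ℝ) ^ (2 * (d + ñ) + 1) * (L : ℝ) ^ (2 * j)
                    / (L : ℝ) ^ ((k - j) * (d - 1 + n))) ∧
            (k ≤ j →
              c / (L : ℝ) ^ (2 * (d + ñ) + 1) * (L : ℝ) ^ (2 * k)
                  ≤ (fourierCoeff (𝒞 L N M A k) κ).re ∧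
              ‖fourierCoeff (𝒞 L N M A k) κ‖ ≤ C * (L : ℝ) ^ (2 * k)) ∧
            ∀ B : Matrix (Fin d) (Fin d) ℝ, IsUnitSymm B → ∀ ℓ : ℕ, 1 ≤ ℓ →
              (j < k →
                ‖iteratedDeriv ℓ (fun s : ℝ => fourierCoeff (𝒞 L N M (A + s • B) k) κ) 0‖
                  ≤ Cℓ ℓ * (L : ℝ) ^ (2 * (d + ñ) + 1) * (L : ℝ) ^ (2 * j)
                      / (L : ℝ) ^ ((k - j) * (d - 1 + ñ))) ∧
              (k ≤ j →
                ‖iteratedDeriv ℓ (fun s : ℝ => fourierCoeff (𝒞 L N M (A + s • B) k) κ) 0‖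
                  ≤ Cℓ ℓ * (L : ℝ) ^ (2 * k)))

end Literature.MathematicalPhysics.StatisticalMechanics.GradientFRD

end
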